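import Summits.AtomisticToContinuum.Crystallization.Theorems.ThreeConeCertificateKeplerBoundBulkWitness
import Summits.AtomisticToContinuum.Crystallization.Theorems.ThreeConeCertificateKeplerBoundBulkSite
import Summits.AtomisticToContinuum.Crystallization.Theorems.ThreeConeCertificateKeplerBound
import Summits.AtomisticToContinuum.Crystallization.Theorems.ThreeConeCertificateDefectVanishCrystallizes

/-!
# `KeplerBound` (stmt-AtomisticToContinuum-11961) from bulk rigidity, III:
# `BulkDefectVanish → KeplerBound` (the hinge alone closes the energetic conjunct)

Support file for the item `ThreeConeCertificate.KeplerBound` (shared with `BraggSlacknessRigidity`).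
MAIN RESULT (`keplerBound_of_bulkDefectVanish`): the shared positional hinge `BulkDefectVanish`
(item stmt-AtomisticToContinuum-0751, crux or support of ten Crystallization routes) IMPLIES the
energetic item `KeplerBound`, unconditionally — hence conjunct (i) `HasPeriodicGroundStateEnergy
lennardJones 3` (`hasPeriodicGroundStateEnergy_of_bulkDefectVanish`) and, with the landed soft
assembly lemma `defectVanishCrystallizes_proof` and the tree theorem
`LennardJonesMinimalDistance_holds`, the whole sub-problem: `BulkDefectVanish → Crystallization`
(`crystallization_of_bulkDefectVanish`).  Likewise `SlackRigidity → KeplerBound`.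

MECHANISM (`siteSum_le_two_mul_eStar`).  Let `P` be rigid along the canonical ground states `gs`
(part I) and `y ∈ P.points`.  Fix `η > 0`; truncate the absolutely convergent site sum
`h(y) = Σ_{q ∈ P, q ≠ y} V(|q − y|)` at a radius `R` beyond which both its remainder and the uniform
ground-state tail `(250/6) δ⁻⁵/(R − 1)` (part IIa) are `< η`; take a modulus `ω = η/(#T + 1)` of
`V_LJ` on `[δ, R + 1]` (Heine–Cantor) and the corresponding tolerance `ε`.  In the ground state
`gs N`, every GOOD particle at `(R + 2, ε)` is — after recentring its chart at `y` by
vertex-transitivity (part I) — matched at `(R, 2ε)` to `P − y`, so its site energy is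
`≥ h_R(y) − η − η` (parts IIa–IIc); every BAD particle has site energy `≥ −C₀ = −(250/6)δ⁻⁶`, and bad
particles are eventually fewer than `θ N`.  Summing, `2E(N)/N ≥ h_R(y) − 2η − θ(C₀ + h_R⁺) ≥ h(y) − 4η`
eventually; since `E(N)/N → e*` (`crysEnergyLimit`), `h(y) ≤ 2e* + 4η`.  Averaging over the motif,
`e(P) = (2#F)⁻¹ Σ_{y ∈ F} h(y) ≤ e*`, and `e* ≤ e(P)` always: `P` is a periodic minimiser and
`KeplerBound` holds (`keplerBound_of_le_eStar`).  All `[folklore]`.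
-/

noncomputable section

open scoped BigOperators Topology
open Filter Set Metric

namespace Summit.AtomisticToContinuum.Crystallization.Theorems.KeplerBoundBulk

open Literature.MathematicalPhysics.StatisticalMechanics
open Summit.AtomisticToContinuum.Crystallization.Theorems.SlackRigidityNegative
open Summit.AtomisticToContinuum.Crystallization.Theses.ThreeConeCertificate
  (BulkDefectVanish SlackRigidity KeplerBound)
open Summit.AtomisticToContinuum.Crystallization.Theorems.ChargedEnergyGapNegative
  (eStar eStar_le crysEnergyLimit)
open Summit.AtomisticToContinuum.Crystallization.Theorems.ChargedEnergyGapNegative.Blocks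
  (siteSum energyPerParticle_eq)

/-! ## § Bookkeeping: good and bad particles -/

/-- **Sum of site energies over good and bad particles.** If every good particle has site
energy `≥ m`, every particle has site energy `≥ −C₀` (`C₀ ≥ 0`), and the bad ones number
`≤ b`, then `Σ_i s_i ≥ N·m − b·(C₀ + max m 0)`. [folklore] -/
theorem sum_ge_of_good_bad {N : ℕ} (s : Fin N → ℝ) (good : Fin N → Prop)
    {m C₀ b : ℝ} (hC₀ : 0 ≤ C₀) (hgood : ∀ i, good i → m ≤ s i) (hall : ∀ i, -C₀ ≤ s i)
    (hb : (Nat.card {i : Fin N // ¬ good i} : ℝ) ≤ b) :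
    (N : ℝ) * m - b * (C₀ + max m 0) ≤ ∑ i, s i := by
  classical
  set G := Finset.univ.filter fun i => good i with hG
  set Bd := Finset.univ.filter fun i => ¬ good i with hBd
  have hb' : (Bd.card : ℝ) ≤ b := by
    have e : Nat.card {i : Fin N // ¬ good i} = Bd.card := by
      rw [Nat.card_eq_fintype_card, Fintype.card_subtype]
    have := hb
    rw [e] at this
    exact this
  have hsplit : ∑ i, s i = ∑ i ∈ G, s i + ∑ i ∈ Bd, s i :=
    (Finset.sum_filter_add_sum_filter_not Finset.univ good s).symm
  have hcard : (G.card : ℝ) + Bd.card = N := by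
    have := Finset.card_filter_add_card_filter_not (s := (Finset.univ : Finset (Fin N))) good
    rw [Finset.card_univ, Fintype.card_fin] at this
    exact_mod_cast this
  have hG_ge : (G.card : ℝ) * m ≤ ∑ i ∈ G, s i := by
    have : ∑ _i ∈ G, m ≤ ∑ i ∈ G, s i :=
      Finset.sum_le_sum fun i hi => hgood i (Finset.mem_filter.1 hi).2
    rwa [Finset.sum_const, nsmul_eq_mul] at this
  have hB_ge : -((Bd.card : ℝ) * C₀) ≤ ∑ i ∈ Bd, s i := by
    have : ∑ _i ∈ Bd, -C₀ ≤ ∑ i ∈ Bd, s i := Finset.sum_le_sum fun i _ => hall i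
    rw [Finset.sum_const, nsmul_eq_mul] at this
    linarith
  have hBd0 : (0 : ℝ) ≤ Bd.card := Nat.cast_nonneg _
  have hm : m ≤ max m 0 := le_max_left _ _
  have hm0 : 0 ≤ max m 0 := le_max_right _ _
  have h1 : (G.card : ℝ) * m ≥ N * m - Bd.card * max m 0 := by
    rw [← hcard]
    nlinarith
  have h2 : (Bd.card : ℝ) * (C₀ + max m 0) ≤ b * (C₀ + max m 0) :=
    mul_le_mul_of_nonneg_right hb' (by linarith)
  rw [hsplit]
  nlinarith

/-! ## § The energy of a ground state with few bad particles -/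

/-- **Twice the ground-state energy from below, at fixed scales.** Let `P` (with `δ`-separated
points, `y ∈ P.points`) come with a vertex-transitivity datum `B` at `y` (radius `R + 1`,
tolerance `ε`), let `T = {q ∈ P.points : q ≠ y, dist q y ≤ R}`, `ω` a modulus of `V_LJ` on
`[δ, R + 1]` at scale `2ε` (`4ε < δ`, `2ε ≤ 1`, `R ≥ 2`), and suppose at most `b` particles of
the (`δ`-separated) ground state `gs N` are bad at `(R + 2, ε)`.  Then
`2 E(N) ≥ N·m − b·(C₀ + m⁺)` with `m = Σ_{q ∈ T} V_LJ(dist q y) − #T·ω − (250/6)δ⁻⁵/(R − 1)` and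
`C₀ = (250/6) δ⁻⁶`. [folklore] -/
theorem two_mul_groundStateEnergy_ge {P : PeriodicConfiguration 3} {y : E3} {R ε δ ω b : ℝ}
    {T : Finset E3} {N : ℕ} (hy : y ∈ P.points)
    (hT : ∀ q, q ∈ T ↔ q ∈ P.points ∧ q ≠ y ∧ dist q y ≤ R)
    (hsep : ∀ k l : Fin N, k ≠ l → δ ≤ dist (gs N k) (gs N l))
    (hPsep : ∀ p ∈ P.points, ∀ q ∈ P.points, p ≠ q → δ ≤ dist p q)
    (hδ : 0 < δ) (hε : 0 < ε) (hεδ : 4 * ε < δ) (hε1 : 2 * ε ≤ 1) (hR : 2 ≤ R)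
    (hω : ∀ s t : ℝ, δ ≤ s → δ ≤ t → s ≤ R + 1 → t ≤ R + 1 → |s - t| ≤ 2 * ε →
      |lennardJones s - lennardJones t| ≤ ω)
    (B : E3 →ₗᵢ[ℝ] E3)
    (hBa : ∀ q ∈ P.points, ‖q‖ ≤ R + 1 → ∃ q' ∈ P.points, dist q' (y + B q) ≤ ε)
    (hBb : ∀ q' ∈ P.points, dist q' y ≤ R + 1 → ∃ q ∈ P.points, dist q' (y + B q) ≤ ε)
    (hb : (badCount P (R + 2) ε (gs N) : ℝ) ≤ b) :
    (N : ℝ) * (∑ q ∈ T, lennardJones (dist q y) - T.card * ω -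
          1 / 6 * ((R - 1)⁻¹ * (250 * δ⁻¹ ^ 5))) -
        b * (1 / 6 * (250 * δ⁻¹ ^ 6) +
          max (∑ q ∈ T, lennardJones (dist q y) - T.card * ω -
            1 / 6 * ((R - 1)⁻¹ * (250 * δ⁻¹ ^ 5))) 0) ≤
      2 * groundStateEnergy lennardJones 3 N := by
  classical
  have hgoodE : ∀ i : Fin N, Good P (R + 2) ε (gs N) i →
      ∑ q ∈ T, lennardJones (dist q y) - T.card * ω - 1 / 6 * ((R - 1)⁻¹ * (250 * δ⁻¹ ^ 5)) ≤
        siteEnergy lennardJones (gs N) i := by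
    intro i hi
    obtain ⟨A', ha', hb'⟩ := matchedAt_of_good (by linarith) hi B hBa hBb
    exact siteEnergy_ge_of_matchedAt (ε := 2 * ε) hT hy ha' hb' hsep hPsep hδ
      (by linarith) (by linarith) hε1 hR hω
  have hallE : ∀ i : Fin N, -(1 / 6 * (250 * δ⁻¹ ^ 6)) ≤ siteEnergy lennardJones (gs N) i :=
    fun i => siteEnergy_lennardJones_ge (gs N) hδ hsep i
  have hsum := sum_ge_of_good_bad (siteEnergy lennardJones (gs N))
    (fun i => Good P (R + 2) ε (gs N) i) (by positivity) hgoodE hallE hb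
  rwa [← two_mul_interactionEnergy, (gs_isGroundState N).2] at hsum

/-! ## § The site sums of a witness are at most `2e*` -/

/-- **Site sums of a rigid periodic configuration are bounded by twice the ground-state energy
per particle**: if `P` is rigid along the canonical Lennard-Jones ground states, then for every
`y ∈ P.points`, `Σ_{q ∈ P, q ≠ y} V_LJ(|y − q|) ≤ 2e*`. [folklore] -/
theorem siteSum_le_two_mul_eStar {P : PeriodicConfiguration 3}
    (hP : ∀ R ε : ℝ, 0 < R → 0 < ε → BadFractionVanishes P R ε gs) {y : E3} (hy : y ∈ P.points) :
    siteSum P lennardJones y ≤ 2 * eStar := by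
  classical
  obtain ⟨δ, hδ, hsep, hPsep'⟩ := gsRigid_uniformlyDiscrete
  have hPsep := hPsep' P hP
  refine le_of_forall_pos_le_add fun η' hη' => ?_
  -- work with `η = η'/4`
  obtain ⟨η, hη, hηη'⟩ : ∃ η : ℝ, 0 < η ∧ 4 * η = η' := ⟨η' / 4, by positivity, by ring⟩
  -- (1) truncation of the site sum at `y`
  have hsum : HasSum (fun q : {q : E3 // q ∈ P.points ∧ q ≠ y} => lennardJones (dist y q.1))
      (siteSum P lennardJones y) := P.hasSum_lennardJones_dist_three y
  obtain ⟨S₀, hS₀⟩ := Metric.tendsto_atTop.1 hsum η hη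
  -- (2) the radius
  have hC₅pos : 0 < 1 / 6 * (250 * δ⁻¹ ^ 5) := by positivity
  obtain ⟨R, hR2, hRS, hRtail⟩ : ∃ R : ℝ, 2 ≤ R ∧ (∀ q ∈ S₀, dist q.1 y ≤ R) ∧
      1 / 6 * ((R - 1)⁻¹ * (250 * δ⁻¹ ^ 5)) ≤ η := by
    refine ⟨2 + ∑ q ∈ S₀, dist q.1 y + 1 / 6 * (250 * δ⁻¹ ^ 5) / η, ?_, ?_, ?_⟩
    · have h0 : 0 ≤ ∑ q ∈ S₀, dist q.1 y := Finset.sum_nonneg fun _ _ => dist_nonneg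
      have h1 : 0 ≤ 1 / 6 * (250 * δ⁻¹ ^ 5) / η := by positivity
      linarith
    · intro q hq
      have h1 : dist q.1 y ≤ ∑ q' ∈ S₀, dist q'.1 y :=
        Finset.single_le_sum (f := fun q' : {q : E3 // q ∈ P.points ∧ q ≠ y} => dist q'.1 y)
          (fun _ _ => dist_nonneg) hq
      have h2 : 0 ≤ 1 / 6 * (250 * δ⁻¹ ^ 5) / η := by positivity
      linarith
    · have h0 : 0 ≤ ∑ q ∈ S₀, dist q.1 y := Finset.sum_nonneg fun _ _ => dist_nonneg
      set C₅ : ℝ := 1 / 6 * (250 * δ⁻¹ ^ 5) with hC₅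
      have hR1 : C₅ / η ≤ 2 + ∑ q ∈ S₀, dist q.1 y + C₅ / η - 1 := by linarith
      have hR1pos : 0 < 2 + ∑ q ∈ S₀, dist q.1 y + C₅ / η - 1 := by
        have : 0 ≤ C₅ / η := by positivity
        linarith
      have hinv : (2 + ∑ q ∈ S₀, dist q.1 y + C₅ / η - 1)⁻¹ ≤ η / C₅ := by
        rw [inv_le_comm₀ hR1pos (by positivity), inv_div]
        exact hR1
      calc 1 / 6 * ((2 + ∑ q ∈ S₀, dist q.1 y + C₅ / η - 1)⁻¹ * (250 * δ⁻¹ ^ 5))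
          = C₅ * (2 + ∑ q ∈ S₀, dist q.1 y + C₅ / η - 1)⁻¹ := by rw [hC₅]; ring
        _ ≤ C₅ * (η / C₅) := mul_le_mul_of_nonneg_left hinv hC₅pos.le
        _ = η := by field_simp
  -- (3) the finite set `T` of points of `P` other than `y` within `R` of `y`
  have hfin : (closedBall y R ∩ P.points).Finite := P.finite_inter_points isBounded_closedBall
  obtain ⟨T, hT⟩ : ∃ T : Finset E3, ∀ q, q ∈ T ↔ q ∈ P.points ∧ q ≠ y ∧ dist q y ≤ R := by
    refine ⟨hfin.toFinset.erase y, fun q => ?_⟩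
    rw [Finset.mem_erase, Set.Finite.mem_toFinset, Set.mem_inter_iff, mem_closedBall]
    constructor
    · rintro ⟨h1, h2, h3⟩; exact ⟨h3, h1, h2⟩
    · rintro ⟨h1, h2, h3⟩; exact ⟨h2, h3, h1⟩
  have hT_sum : siteSum P lennardJones y < ∑ q ∈ T, lennardJones (dist q y) + η := by
    have hle : S₀ ≤ T.subtype fun q => q ∈ P.points ∧ q ≠ y := by
      intro q hq
      rw [Finset.mem_subtype]
      exact (hT q.1).2 ⟨q.2.1, q.2.2, hRS q hq⟩
    have h1 := hS₀ _ hle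
    have h2 : ∑ q ∈ T.subtype (fun q => q ∈ P.points ∧ q ≠ y), lennardJones (dist y q.1) =
        ∑ q ∈ T, lennardJones (dist q y) := by
      have h3 := Finset.sum_subtype_eq_sum_filter (s := T) (fun q : E3 => lennardJones (dist y q))
        (p := fun q => q ∈ P.points ∧ q ≠ y)
      rw [Finset.filter_true_of_mem (fun q hq => ⟨((hT q).1 hq).1, ((hT q).1 hq).2.1⟩)] at h3
      rw [h3]
      exact Finset.sum_congr rfl fun q _ => by rw [dist_comm]
    rw [Real.dist_eq, h2] at h1
    linarith [(abs_sub_lt_iff.1 h1).2]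
  -- (4) modulus of continuity of `V_LJ` on `[δ, R + 1]` at scale `2ε`, with `#T·ω ≤ η`
  obtain ⟨ω, hωpos, hTω⟩ : ∃ ω : ℝ, 0 < ω ∧ (T.card : ℝ) * ω ≤ η := by
    refine ⟨η / (T.card + 1), by positivity, ?_⟩
    rw [mul_div_assoc', div_le_iff₀ (by positivity)]
    linarith [mul_nonneg (Nat.cast_nonneg T.card) hη.le]
  have hcont : ContinuousOn lennardJones (Set.Icc δ (R + 1)) :=
    continuousOn_lennardJones.mono fun s hs h0 => by
      have h00 : (s : ℝ) = 0 := h0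
      have := hs.1
      linarith
  obtain ⟨ε₀, hε₀, hmod⟩ := Metric.uniformContinuousOn_iff_le.1
    (isCompact_Icc.uniformContinuousOn_of_continuous hcont) ω hωpos
  obtain ⟨ε, hε, hεε₀, hεδ, hε1⟩ : ∃ ε : ℝ, 0 < ε ∧ 2 * ε ≤ ε₀ ∧ 4 * ε < δ ∧ 2 * ε ≤ 1 := by
    refine ⟨min (ε₀ / 2) (min (δ / 8) (1 / 2)), ?_, ?_, ?_, ?_⟩
    · exact lt_min (by linarith) (lt_min (by linarith) (by norm_num))
    · linarith [min_le_left (ε₀ / 2) (min (δ / 8) (1 / 2))]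
    · linarith [min_le_right (ε₀ / 2) (min (δ / 8) (1 / 2)), min_le_left (δ / 8) (1 / 2 : ℝ)]
    · linarith [min_le_right (ε₀ / 2) (min (δ / 8) (1 / 2)), min_le_right (δ / 8) (1 / 2 : ℝ)]
  have hωmod : ∀ s t : ℝ, δ ≤ s → δ ≤ t → s ≤ R + 1 → t ≤ R + 1 → |s - t| ≤ 2 * ε →
      |lennardJones s - lennardJones t| ≤ ω := by
    intro s t hs ht hsR htR hst
    have := hmod s ⟨hs, hsR⟩ t ⟨ht, htR⟩ (by rw [Real.dist_eq]; linarith)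
    rwa [Real.dist_eq] at this
  -- (5) vertex-transitivity datum at `y`, radius `R + 1`, tolerance `ε`
  obtain ⟨B, hBa, hBb⟩ := vertexTransitive_of_gsRigid hP hy (R := R + 1) (by linarith) hε
  -- (6) the constants `m`, `C₀`, `θ`
  set m : ℝ := ∑ q ∈ T, lennardJones (dist q y) - T.card * ω -
    1 / 6 * ((R - 1)⁻¹ * (250 * δ⁻¹ ^ 5)) with hm
  set C₀ : ℝ := 1 / 6 * (250 * δ⁻¹ ^ 6) with hC₀
  have hC₀0 : 0 ≤ C₀ := by positivity
  have hmax : 0 ≤ max m 0 := le_max_right _ _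
  obtain ⟨θ, hθpos, hθle⟩ : ∃ θ : ℝ, 0 < θ ∧ θ * (C₀ + max m 0) ≤ η := by
    refine ⟨η / (C₀ + max m 0 + 1), by positivity, ?_⟩
    rw [div_mul_eq_mul_div, div_le_iff₀ (by positivity)]
    nlinarith [hη.le, hC₀0, hmax]
  -- (7) eventually: few bad particles, hence `E(N)/N ≥ (m − η)/2`
  have hfew : FewBad fun N i => Good P (R + 2) ε (gs N) i := hP (R + 2) ε (by linarith) hε
  have hev : ∀ᶠ N : ℕ in atTop, (m - η) / 2 ≤ groundStateEnergy lennardJones 3 N / N := by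
    filter_upwards [hfew.eventually_lt hθpos, eventually_ge_atTop 1] with N hbad hN1
    have hNpos : (0 : ℝ) < N := by exact_mod_cast hN1
    have hbad' : (badCount P (R + 2) ε (gs N) : ℝ) ≤ θ * N := hbad.le
    have hmain := two_mul_groundStateEnergy_ge hy hT (hsep N) hPsep hδ hε hεδ hε1 hR2 hωmod
      B hBa hBb hbad'
    rw [← hm, ← hC₀] at hmain
    have h3 : (N : ℝ) * (θ * (C₀ + max m 0)) ≤ N * η := mul_le_mul_of_nonneg_left hθle hNpos.le
    rw [div_le_div_iff₀ (by norm_num : (0 : ℝ) < 2) hNpos]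
    have h4 : θ * N * (C₀ + max m 0) = N * (θ * (C₀ + max m 0)) := by ring
    rw [h4] at hmain
    linarith
  -- (8) pass to the limit `E(N)/N → e*` and collect
  have hlim : (m - η) / 2 ≤ eStar := ge_of_tendsto crysEnergyLimit hev
  rw [hm] at hlim
  rw [← hηη']
  linarith

/-! ## § Consequences: the witness is a periodic minimiser; `KeplerBound`; the conjunct -/

/-- **A periodic configuration rigid along the ground states has energy per particle `≤ e*`**
(average the site-sum bound over the motif: `e(P) = (2#F)⁻¹ Σ_{y ∈ F} h(y)`). [folklore] -/
theorem energyPerParticle_le_eStar_of_gsRigid {P : PeriodicConfiguration 3}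
    (hP : ∀ R ε : ℝ, 0 < R → 0 < ε → BadFractionVanishes P R ε gs) :
    P.energyPerParticle lennardJones ≤ eStar := by
  have hF : (0 : ℝ) < P.motif.card := by exact_mod_cast P.motif_nonempty.card_pos
  rw [energyPerParticle_eq]
  have hle : ∑ x ∈ P.motif, siteSum P lennardJones x ≤ ∑ _x ∈ P.motif, 2 * eStar :=
    Finset.sum_le_sum fun x hx => siteSum_le_two_mul_eStar hP (P.mem_points_of_mem_motif hx)
  rw [Finset.sum_const, nsmul_eq_mul] at hle
  calc (2 * (P.motif.card : ℝ))⁻¹ * ∑ x ∈ P.motif, siteSum P lennardJones x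
      ≤ (2 * (P.motif.card : ℝ))⁻¹ * (P.motif.card * (2 * eStar)) :=
        mul_le_mul_of_nonneg_left hle (by positivity)
    _ = eStar := by field_simp

/-- Hence **it is a periodic minimiser**: `e(P) = e* = ⨅_Q e(Q)`. [folklore] -/
theorem energyPerParticle_eq_eStar_of_gsRigid {P : PeriodicConfiguration 3}
    (hP : ∀ R ε : ℝ, 0 < R → 0 < ε → BadFractionVanishes P R ε gs) :
    P.energyPerParticle lennardJones = eStar :=
  le_antisymm (energyPerParticle_le_eStar_of_gsRigid hP) (eStar_le P)

/-- … and attains the least periodic energy per particle. [folklore] -/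
theorem isLeast_of_gsRigid {P : PeriodicConfiguration 3}
    (hP : ∀ R ε : ℝ, 0 < R → 0 < ε → BadFractionVanishes P R ε gs) :
    IsLeast (Set.range fun Q : PeriodicConfiguration 3 => Q.energyPerParticle lennardJones)
      (P.energyPerParticle lennardJones) := by
  refine ⟨⟨P, rfl⟩, ?_⟩
  rintro _ ⟨Q, rfl⟩
  exact (energyPerParticle_le_eStar_of_gsRigid hP).trans (eStar_le Q)

/-- **`KeplerBound` from rigidity along the ground states.** [folklore] -/
theorem keplerBound_of_gsRigid {P : PeriodicConfiguration 3}
    (hP : ∀ R ε : ℝ, 0 < R → 0 < ε → BadFractionVanishes P R ε gs) : KeplerBound :=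
  keplerBound_of_le_eStar (energyPerParticle_le_eStar_of_gsRigid hP)

/-- **MAIN: the hinge implies the Kepler bound — `BulkDefectVanish → KeplerBound`.** The shared
positional hinge (item 0751) alone yields the route's energetic support item (item 11961): no
certificate, no separate energetic crux is needed on any route that proves `BulkDefectVanish`.
[folklore] -/
theorem keplerBound_of_bulkDefectVanish (h : BulkDefectVanish) : KeplerBound := by
  obtain ⟨P, hP⟩ := exists_gsRigid_of_bulkDefectVanish h
  exact keplerBound_of_gsRigid hP

/-- **`SlackRigidity → KeplerBound`** (the route's rank-4 crux also yields the energetic item,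
independently of `ExactCertificate`). [folklore] -/
theorem keplerBound_of_slackRigidity (h : SlackRigidity) : KeplerBound := by
  obtain ⟨P, hP⟩ := exists_gsRigid_of_slackRigidity h
  exact keplerBound_of_gsRigid hP

/-- **The hinge implies conjunct (i)**: `BulkDefectVanish → HasPeriodicGroundStateEnergy V_LJ 3`.
[folklore] -/
theorem hasPeriodicGroundStateEnergy_of_bulkDefectVanish (h : BulkDefectVanish) :
    HasPeriodicGroundStateEnergy lennardJones 3 :=
  keplerBound_iff_hasPeriodicGroundStateEnergy.1 (keplerBound_of_bulkDefectVanish h)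

/-- **The hinge alone closes the sub-problem**: `BulkDefectVanish → Crystallization` (conjunct
(i) by the above, conjunct (ii) by the landed soft assembly lemma `defectVanishCrystallizes_proof`
and the tree theorem `LennardJonesMinimalDistance_holds`). [folklore] -/
theorem crystallization_of_bulkDefectVanish (h : BulkDefectVanish) : _root_.Crystallization :=
  ⟨hasPeriodicGroundStateEnergy_of_bulkDefectVanish h,
    ThreeConeCertificateDefectVanishCrystallizes.defectVanishCrystallizes_proof h
      LennardJonesMinimalDistance_holds⟩

/-- Likewise `SlackRigidity → Crystallization` (ground states are injective with zero excess).
[folklore] -/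
theorem crystallization_of_slackRigidity (h : SlackRigidity) : _root_.Crystallization := by
  obtain ⟨P, hP⟩ := h
  exact crystallization_of_bulkDefectVanish
    ⟨P, fun R ε hR hε x hx => hP R ε hR hε x (fun N => (hx N).1) (excessVanishes_of_isGroundState hx)⟩

end Summit.AtomisticToContinuum.Crystallization.Theorems.KeplerBoundBulk

end
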